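import Mathlib
import Literature.NumberTheory.NumberFields.CMTwistNormGlueRows
import HarnessLib

/-!
# Three more glue rows for the twist-norm law `(n) = 𝔞 · c𝔞` of a CM field: `n` is prime to a level prime to `𝔞`, `n ≠ 0`, and `n ∈ 𝔞`

Topic `Literature/NumberTheory/NumberFields`, namespace `Literature.NumberTheory.NumberFields`.  THEOREMS ONLY (no `def`, no instance, no named fact);
Mathlib + ★ `CMTwistNormGlueRows` (`natCast_dvd_natCast_ringOfIntegers_iff`).

## Source (read at the page) and what is recorded

G. Shimura, *Abelian Varieties with Complex Multiplication and Modular Functions* (1998), §13.1 Theorem 1 (pp. 97–99): the Frobenius twist ideal `𝔞` of a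
CM abelian variety at a good place satisfies the norm equation `𝔞 𝔞^ρ = (q)`; in the moduli problem with level `N` prime to `𝔞` the integer `q` is then prime
to `N`, nonzero, and lies in `𝔞` — the three ELEMENTARY inputs (`hcop`, `hN`, `hNmem`) under which a Serre presentation of `𝔞` WITH THE PRESCRIBED SCALAR `q`
(★ `exists_serrePresentation_of_ideal_of_natCast_mem`) feeds the level transport ★ `LevelStructure.existsUnique_serreTwist` (cell `hodgecm-mathlib`, line L3,
the `(cov)` conjunct `stub_COV0` of `stub_TWISTCOVER0`; LA3-plan DEAL v5 (g2)(g3)).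
* `natCast_mem_of_span_eq_mul_complexConj_smul` — `(n) = 𝔞 · c𝔞 ⇒ n ∈ 𝔞`;
* `ne_zero_of_span_eq_mul_complexConj_smul` — `(n) = 𝔞 · c𝔞`, `𝔞 ≠ 0 ⇒ n ≠ 0`;
* `coprime_of_span_eq_mul_complexConj_smul_of_sup_span_eq_top` — `(n) = 𝔞 · c𝔞`, `𝔞 + (N) = 𝒪 ⇒ gcd(n, N) = 1` (`c` fixes `(N)`, so `c𝔞 + (N) = 𝒪` too, hence
  `(n) + (N) = 𝔞·c𝔞 + (N) = 𝒪`; a common divisor `d ∈ ℕ` of `n, N` is then a unit of `𝓞 F`, i.e. `d = 1` by ★ `natCast_dvd_natCast_ringOfIntegers_iff`).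
`--supports stmt-HodgeConjecture-24832`, count-neutral.

## Mathlib / tree search

Mathlib: `Ideal.isCoprime_iff_sup_eq`, `IsCoprime.mul_left`, `Ideal.isCoprime_span_singleton_iff`, `IsCoprime.isUnit_of_dvd'`, `isUnit_iff_dvd_one`,
`Ideal.pointwise_smul_def`, `Ideal.map_sup`, `Ideal.map_span`, `Ideal.map_top`, `Ideal.mul_le_right`, `Ideal.mem_span_singleton_self`, `mul_ne_zero`,
`smul_mem_pointwise_smul`; tree ★ `CMTwistNormGlueRows` (same token shape `(n) = 𝔞 · c𝔞`).
-/

namespace Literature.NumberTheory.NumberFields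

open NumberField IsDedekindDomain
open scoped Pointwise

variable {F : Type*} [Field F] [NumberField F] [IsCMField F]

/-- **`(n) = 𝔞 · c𝔞 ⇒ n ∈ 𝔞`** (`𝔞 · c𝔞 ⊆ 𝔞`). [cite: Shimura1998, §13.1 Thm. 1 (pp. 97–99)] -/
theorem natCast_mem_of_span_eq_mul_complexConj_smul {𝔞 : Ideal (𝓞 F)} {n : ℕ}
    (h : Ideal.span {((n : ℕ) : 𝓞 F)} = 𝔞 * (IsCMField.complexConj F) • 𝔞) : ((n : ℕ) : 𝓞 F) ∈ 𝔞 :=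
  Ideal.mul_le_right (h ▸ Ideal.mem_span_singleton_self _)

/-- **`(n) = 𝔞 · c𝔞` and `𝔞 ≠ 0 ⇒ n ≠ 0`** (`𝓞 F` is a domain and `c` is injective: a nonzero `a ∈ 𝔞` gives `0 ≠ a · c a ∈ (n)`).
[cite: Shimura1998, §13.1 Thm. 1 (pp. 97–99)] -/
theorem ne_zero_of_span_eq_mul_complexConj_smul {𝔞 : Ideal (𝓞 F)} {n : ℕ}
    (h : Ideal.span {((n : ℕ) : 𝓞 F)} = 𝔞 * (IsCMField.complexConj F) • 𝔞) (h𝔞 : 𝔞 ≠ ⊥) : n ≠ 0 := by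
  obtain ⟨a, ha, ha0⟩ := Submodule.exists_mem_ne_zero_of_ne_bot h𝔞
  have hca : (IsCMField.complexConj F) • a ∈ (IsCMField.complexConj F) • 𝔞 := Ideal.smul_mem_pointwise_smul _ _ 𝔞 ha
  have hca0 : (IsCMField.complexConj F) • a ≠ 0 := by
    intro h0
    exact ha0 (by simpa using congrArg (fun x => (IsCMField.complexConj F)⁻¹ • x) h0)
  have hmem : a * (IsCMField.complexConj F) • a ∈ Ideal.span {((n : ℕ) : 𝓞 F)} := h ▸ Ideal.mul_mem_mul ha hca
  rintro rfl
  rw [Nat.cast_zero, Ideal.span_singleton_zero, Ideal.mem_bot] at hmem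
  exact mul_ne_zero ha0 hca0 hmem

/-- **`(n) = 𝔞 · c𝔞` and `𝔞 + (N) = 𝒪 ⇒ gcd(n, N) = 1`**: complex conjugation fixes `(N)`, so `c𝔞 + (N) = 𝒪` as well and `(n) + (N) = 𝔞 · c𝔞 + (N) = 𝒪`; a common
natural divisor of `n` and `N` is then a unit of `𝓞 F`, i.e. `1`.  (The level `N` of the moduli problem is prime to the twist ideal; this makes the twist norm prime
to the level, the `hcop` of ★ `LevelStructure.existsUnique_serreTwist`.) [cite: Shimura1998, §13.1 Thm. 1 (pp. 97–99)] -/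
theorem coprime_of_span_eq_mul_complexConj_smul_of_sup_span_eq_top {𝔞 : Ideal (𝓞 F)} {n N : ℕ}
    (h : Ideal.span {((n : ℕ) : 𝓞 F)} = 𝔞 * (IsCMField.complexConj F) • 𝔞) (hN : 𝔞 ⊔ Ideal.span {((N : ℕ) : 𝓞 F)} = ⊤) :
    Nat.Coprime n N := by
  have h1 : IsCoprime 𝔞 (Ideal.span {((N : ℕ) : 𝓞 F)}) := Ideal.isCoprime_iff_sup_eq.2 hN
  have h2 : IsCoprime ((IsCMField.complexConj F) • 𝔞) (Ideal.span {((N : ℕ) : 𝓞 F)}) := by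
    rw [Ideal.isCoprime_iff_sup_eq]
    have := congrArg (Ideal.map (MulSemiringAction.toRingHom _ (𝓞 F) (IsCMField.complexConj F))) hN
    rwa [Ideal.map_sup, Ideal.map_span, Set.image_singleton, MulSemiringAction.toRingHom_apply, ← MulSemiringAction.toRingHom_apply,
      map_natCast, Ideal.map_top, ← Ideal.pointwise_smul_def] at this
  have h3 : IsCoprime ((n : ℕ) : 𝓞 F) ((N : ℕ) : 𝓞 F) := by
    rw [← Ideal.isCoprime_span_singleton_iff, h]
    exact h1.mul_left h2
  have hd1 : ((Nat.gcd n N : ℕ) : 𝓞 F) ∣ ((n : ℕ) : 𝓞 F) := Nat.cast_dvd_cast (Nat.gcd_dvd_left n N)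
  have hd2 : ((Nat.gcd n N : ℕ) : 𝓞 F) ∣ ((N : ℕ) : 𝓞 F) := Nat.cast_dvd_cast (Nat.gcd_dvd_right n N)
  have hu : ((Nat.gcd n N : ℕ) : 𝓞 F) ∣ ((1 : ℕ) : 𝓞 F) := by
    rw [Nat.cast_one]
    exact isUnit_iff_dvd_one.1 (h3.isUnit_of_dvd' hd1 hd2)
  exact Nat.dvd_one.1 (natCast_dvd_natCast_ringOfIntegers_iff.1 hu)

end Literature.NumberTheory.NumberFields
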